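import Summits.CriticalPhenomena.PercolationContinuityZ3.Theorems.PercNearOneGluingNoHeavyLowerTailCertRowsTwoSet
import Summits.CriticalPhenomena.PercolationContinuityZ3.Theorems.PercNearOneGluingNoHeavyLowerTailCertGeneral
import Summits.CriticalPhenomena.PercolationContinuityZ3.Theorems.PercNearOneGluingNoHeavyLowerTailCertRowsGroupData
import HarnessLib

/-!
# `NoHeavyLowerTail` (stmt-CriticalPhenomena-4575) — the exchange inequality `Ψ(0) ≥ 0` under `μ(j↔b) ≤ μ(z↔b)`
# (lead LEAD-GEN11 §3h claim (b), variant B) for EVERY finite weighted graph, from a degree-2 law-level certificate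

Support file (certificate seat `prim-cert-1`, gen 5; `--supports stmt-CriticalPhenomena-4575`).  No named facts, no sorries,
standard axioms.  The crux itself is closed; this is a helper theorem of the structural (Kozma–Nitzan Question 9) line.

SETTING.  Five terminals placed by `v : Fin 5 → Fin n`: `0 = b` (sink), `1 = z` (in the application: a glued block), `2 = j`
(witness relay), `3 = p`, `4 = q` (the two ports; `A = {p, q}`).  The linear functional of the 5-terminal connection law
  `Ψ := μ(z↔b) + μ({p↔b ∨ q↔b} ∧ {z ↮ b, p, q, j}) − μ(j↔b) − μ({z↔b} ∧ {p↮b} ∧ {q↮b} ∧ {j↔p ∨ j↔q})`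
is the lead's `Ψ_Y(0) = (gain_z − gain_j) + (z − j)_L` written on the law of `L` (prim-nh-lead-4575 LEAD-GEN11 §3h; the glued
worlds `L/{p,q}` and `L/{p,q,z}` are push-forwards of the partition law, cp-gz PHI-PSI-CERT.md STEP 0), equivalently prim-lf-3's
`T(i)`-functional `D − a_j + a_z` (LF3-BETA-R.md §16b).  CLAIM (b), variant B, of LEAD-GEN11 §3h: `Ψ ≥ 0` whenever `μ(j↔b) ≤ μ(z↔b)`.

PROOF = a degree-2 Positivstellensatz certificate found by LP (this seat, kit j087977; independently ttrl cp-gz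
`gz/certs/cert_gz_PSI0B_D2.json`), replayed by the reflective checker `CertCheck.checkQ` (`…CertGeneral`):
  `(Σ_{27 cells} w_c x_c) · Ψ(x) = R₁(x) + R₂(x) + Σ_{16 cells} h_c x_c · (μ(z↔b) − μ(j↔b)) + (slack with nonnegative coefficients)`
coefficientwise in the 52 cell variables, where `R₁, R₂ ≥ 0` are two van den Berg–Häggström–Kahn two-set conditional-association rows
on the separation `{z ↮ j}` (`CertCells.twoSetRow_holds`, BHK 2006 Thm 1.5 / 2.1):
  `R₁ : μ(D ∧ A ∧ B)·μ(D) ≤ μ(D ∧ A)·μ(D ∧ B)`,  `D = {j↮z}`, `A = {b↮z}` (type (+) for `({j},{z})`), `B = E₂` (type (−)),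
  `R₂ : μ(D ∧ A′)·μ(D ∧ E₂) ≤ μ(D ∧ A′ ∧ E₂)·μ(D)`,  `A′ = {b↮j}`, `E₂` (both type (+) for `({z},{j})`),
  `E₂ = (z↔p ∨ q↮j) ∧ (z↔q ∨ p↮j)` (as a DNF of four clauses; all inside `D`).
The multiplier `M₀ = Σ w_c x_c` is a nonnegative cell mass which MAY VANISH; but every cell on which `Ψ` has a negative net
coefficient carries positive `M₀`-weight (`tneg_subset`), so on the face `M₀ = 0` the functional `Ψ` is a sum of nonnegative cells.
Hence `Ψ ≥ 0` for EVERY weight vector and EVERY placement (`psiZeroB_cells`, `psiZeroB`), with no positivity proviso and no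
injectivity hypothesis.  (The companion claim under `μ(j↔b) ≤ μ(p↔b), μ(q↔b)` = LEMMA T(i) has NO certificate of degree ≤ 2 over
the same row cone — this seat's kit j085711…j086095 and cp-gz D = 2; degree 3 is running.)
[cite: VandenbergHaggstromKahn2005, Thm. 1.5 (p. 7), Thm. 2.1 (p. 9)] [cite: KozmaNitzan2024, §5.5 (p. 36)]
-/

noncomputable section

namespace Summit.CriticalPhenomena.PercolationContinuityZ3.Theorems

open MeasureTheory Set Literature.Probability.Percolation
open Literature.Probability.LatticeModels (prodBernoulli)
open scoped Classical BigOperators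
open PatternCells CertCheck CertCells

namespace PsiZeroB

variable {n : ℕ}

/-! ## The four events of `Ψ` and the hypothesis, as formulas (terminals `0=b,1=z,2=j,3=p,4=q`) -/

/-- `{z ↔ b}`. [folklore] -/
def fZB : Formula := [[(1, 0, true)]]

/-- `{j ↔ b}`. [folklore] -/
def fJB : Formula := [[(2, 0, true)]]

/-- `{p↔b ∨ q↔b} ∧ {z ↮ b} ∧ {z ↮ p} ∧ {z ↮ q} ∧ {z ↮ j}` (`A` reaches `b`, `z` isolated from the other terminals). [folklore] -/
def fABEZ : Formula :=
  [[(3, 0, true), (1, 0, false), (1, 3, false), (1, 4, false), (1, 2, false)],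
    [(4, 0, true), (1, 0, false), (1, 3, false), (1, 4, false), (1, 2, false)]]

/-- `{z↔b} ∧ {p↮b} ∧ {q↮b} ∧ ({j↔p} ∨ {j↔q})`. [folklore] -/
def fLAST : Formula :=
  [[(1, 0, true), (3, 0, false), (4, 0, false), (2, 3, true)], [(1, 0, true), (3, 0, false), (4, 0, false), (2, 4, true)]]

/-- The functional `Ψ` at a cell valuation `x`. [this file] -/
def psiVal (x : ℕ → ℝ) : ℝ :=
  linEval x (cellsOf fZB) + linEval x (cellsOf fABEZ) - linEval x (cellsOf fJB) - linEval x (cellsOf fLAST)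

/-! ## Certificate data -/

/-- The multiplier cells with their (integer, ×44) weights. [this file] -/
def m0 : List (ℕ × ℕ) := [(0, 1), (2, 2), (4, 2), (8, 2), (32, 1), (34, 2), (40, 1), (64, 1), (66, 2), (68, 1), (128, 1), (134, 2), (136, 3), (192, 1), (198, 2), (256, 1), (260, 3), (266, 2), (288, 1), (298, 2), (512, 1), (514, 2), (524, 2), (608, 1), (610, 2), (896, 1), (910, 2)]

/-- The hypothesis-row multiplier cells with weights. [this file] -/
def hy : List (ℕ × ℕ) := [(0, 1), (2, 2), (32, 1), (34, 2), (40, 1), (64, 1), (66, 2), (68, 1), (192, 1), (198, 2), (288, 1), (298, 2), (512, 1), (514, 2), (608, 1), (610, 2)]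

/-- `M₀(x) = Σ w_c x_c`. [this file] -/
def m0lin (x : ℕ → ℝ) : ℝ := (m0.map fun p => (p.2 : ℝ) * x p.1).sum

/-- The signed quadratic form `M₀ · Ψ` as checker terms (`x_c · μ(E)` for each multiplier cell and each event of `Ψ`). [this file] -/
def ts : List QTerm :=
  m0.flatMap fun p => [⟨[p.1], cellsOf fZB, p.2, true⟩, ⟨[p.1], cellsOf fABEZ, p.2, true⟩,
    ⟨[p.1], cellsOf fJB, p.2, false⟩, ⟨[p.1], cellsOf fLAST, p.2, false⟩]

/-- The event `E₂ = (z↔p ∨ q↮j) ∧ (z↔q ∨ p↮j)` as a DNF. [this file] -/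
def fE2 : Formula := [[(1, 3, true), (1, 4, true)], [(1, 3, true), (2, 3, false)], [(2, 4, false), (1, 4, true)], [(2, 4, false), (2, 3, false)]]

/-- Row 1: `twoSetRow {j} {z}` with `A₁ = {b↮z}`, `B₁ = E₂` (`μ(D A₁ B₁) μ(D) ≤ μ(D A₁) μ(D B₁)`). [this file] -/
def row1 : Row := twoSetRow [2] [1] [[(0, 1, false)]] [[]] fE2 [[]] [] 1

/-- Row 2: `twoSetRow {z} {j}` with `A₁ = {b↮j}`, `A₂ = E₂` (`μ(D A₁) μ(D A₂) ≤ μ(D A₁ A₂) μ(D)`). [this file] -/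
def row2 : Row := twoSetRow [1] [2] [[(0, 2, false)]] fE2 [[]] [[]] [] 1

/-- The hypothesis rows `x_c · μ(j↔b) ≤ x_c · μ(z↔b)`. [this file] -/
def lrows : List LinRow := hy.map fun p => ⟨cellsOf fJB, cellsOf fZB, [p.1], p.2⟩

/-- **The kernel check of the certificate** (coefficientwise domination, `CertCheck.checkQ` with constant multiplier `1`). [this file] -/
theorem check : checkQ [([], 1)] ts [row1, row2] lrows = true := by
  decide +kernel

/-! ## From the check to `M₀ · Ψ ≥ 0` at any nonnegative valuation satisfying the rows -/

/-- The checker's quadratic form is `M₀ · Ψ`. [this file] -/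
theorem qval_ts (x : ℕ → ℝ) : qval x ts = m0lin x * psiVal x := by
  simp only [qval, ts, m0, m0lin, psiVal, QTerm.val, List.flatMap_cons, List.flatMap_nil, List.map_cons, List.map_nil,
    List.map_append, List.sum_append, List.sum_cons, List.sum_nil, linEval_single, Bool.false_eq_true, ite_true, ite_false]
  push_cast
  ring

/-- **Cell-level soundness**: at any `x ≥ 0` where the two rows and the hypothesis row hold, `0 ≤ M₀(x) · Ψ(x)`. [this file] -/
theorem m0_mul_psi_nonneg (x : ℕ → ℝ) (hx : ∀ i, 0 ≤ x i)
    (h1 : linEval x row1.e1 * linEval x row1.e2 ≤ linEval x row1.e3 * linEval x row1.e4)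
    (h2 : linEval x row2.e1 * linEval x row2.e2 ≤ linEval x row2.e3 * linEval x row2.e4)
    (hhyp : linEval x (cellsOf fJB) ≤ linEval x (cellsOf fZB)) : 0 ≤ m0lin x * psiVal x := by
  have hrows := rowSumLE_of_forall x hx [row1, row2] (by
    intro r hr
    simp only [List.mem_cons, List.mem_nil_iff, or_false] at hr
    rcases hr with rfl | rfl
    · exact h1
    · exact h2)
  have hl : ∀ r ∈ lrows, linEval x r.eLo ≤ linEval x r.eHi := by
    intro r hr
    simp only [lrows, List.mem_map] at hr
    obtain ⟨p, _, rfl⟩ := hr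
    exact hhyp
  have key := soundQ x hx [([], 1)] ts [row1, row2] lrows hrows hl check
  have hm : m0val x [([], 1)] = 1 := by simp [m0val, evalM]
  rw [hm, one_mul, qval_ts] at key
  exact key

/-! ## The face `M₀ = 0`: every negative cell of `Ψ` carries `M₀`-weight -/

/-- The cells of `Ψ` with net coefficient `+1` (with multiplicity). [this file] -/
def tpos : List ℕ := [1, 4, 8, 37, 73, 136, 201, 260, 293, 513, 524, 621]

/-- The cells of `Ψ` with net coefficient `−1`. [this file] -/
def tneg : List ℕ := [2, 34, 66, 198, 298, 514, 610]

/-- Net form of `Ψ`: positive cells minus negative cells (a linear identity in the 52 cell variables). [this file] -/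
theorem psiVal_eq (x : ℕ → ℝ) : psiVal x = linEval x tpos - linEval x tneg := by
  have hZB : cellsOf fZB = [1, 19, 37, 73, 129, 183, 201, 257, 293, 347, 513, 531, 621, 897, 1023] := by decide +kernel
  have hJB : cellsOf fJB = [2, 19, 34, 66, 134, 183, 198, 266, 298, 347, 514, 531, 610, 910, 1023] := by decide +kernel
  have hAB : cellsOf fABEZ = [4, 8, 134, 136, 260, 266, 524, 910] := by decide +kernel
  have hLA : cellsOf fLAST = [129, 257, 897] := by decide +kernel
  simp only [psiVal, hZB, hJB, hAB, hLA, tpos, tneg, linEval, List.map_cons, List.map_nil, List.sum_cons, List.sum_nil]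
  ring

/-- Every negative cell of `Ψ` is a multiplier cell (with positive weight). [this file] -/
theorem tneg_subset : ∀ c ∈ tneg, ∃ p ∈ m0, p.1 = c ∧ 0 < p.2 := by decide +kernel

/-- On the face `M₀(x) = 0` (with `x ≥ 0`) all multiplier cells vanish. [this file] -/
theorem cells_zero_of_m0lin_zero (x : ℕ → ℝ) (hx : ∀ i, 0 ≤ x i) (h0 : m0lin x = 0) :
    ∀ p ∈ m0, 0 < p.2 → x p.1 = 0 := by
  intro p hp hw
  have hnn : ∀ q ∈ m0, 0 ≤ (q.2 : ℝ) * x q.1 := fun q _ => mul_nonneg (Nat.cast_nonneg _) (hx _)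
  have hle : (p.2 : ℝ) * x p.1 ≤ m0lin x :=
    List.single_le_sum (fun y hy => by
      obtain ⟨q, hq, rfl⟩ := List.mem_map.1 hy
      exact hnn q hq) _ (List.mem_map.2 ⟨p, hp, rfl⟩)
  rw [h0] at hle
  have hge : 0 ≤ (p.2 : ℝ) * x p.1 := hnn p hp
  have hzero : (p.2 : ℝ) * x p.1 = 0 := le_antisymm hle hge
  rcases mul_eq_zero.1 hzero with h | h
  · exact absurd h (by exact_mod_cast hw.ne')
  · exact h

/-- **`Ψ ≥ 0` at the cell level**, for every `x ≥ 0` satisfying the two rows and the hypothesis row (no positivity proviso). [this file] -/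
theorem psiVal_nonneg (x : ℕ → ℝ) (hx : ∀ i, 0 ≤ x i)
    (h1 : linEval x row1.e1 * linEval x row1.e2 ≤ linEval x row1.e3 * linEval x row1.e4)
    (h2 : linEval x row2.e1 * linEval x row2.e2 ≤ linEval x row2.e3 * linEval x row2.e4)
    (hhyp : linEval x (cellsOf fJB) ≤ linEval x (cellsOf fZB)) : 0 ≤ psiVal x := by
  have hM := m0_mul_psi_nonneg x hx h1 h2 hhyp
  have hm0 : 0 ≤ m0lin x := List.sum_nonneg fun y hy => by
    obtain ⟨q, _, rfl⟩ := List.mem_map.1 hy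
    exact mul_nonneg (Nat.cast_nonneg _) (hx _)
  rcases hm0.lt_or_eq with hpos | hzero
  · by_contra hneg
    push Not at hneg
    have : m0lin x * psiVal x < 0 := mul_neg_of_pos_of_neg hpos hneg
    linarith
  · -- the face `M₀ = 0`
    have hc := cells_zero_of_m0lin_zero x hx hzero.symm
    have hneg0 : linEval x tneg = 0 := by
      unfold linEval
      apply List.sum_eq_zero
      intro y hy
      obtain ⟨c, hcm, rfl⟩ := List.mem_map.1 hy
      obtain ⟨p, hp, hpc, hw⟩ := tneg_subset c hcm
      rw [← hpc]
      exact hc p hp hw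
    have hpos0 : 0 ≤ linEval x tpos := by
      unfold linEval
      exact List.sum_nonneg fun y hy => by
        obtain ⟨c, _, rfl⟩ := List.mem_map.1 hy
        exact hx c
    rw [psiVal_eq, hneg0, sub_zero]
    exact hpos0

/-! ## Measure level: every finite weighted graph, every placement of the five terminals -/

/-- **`Ψ(0) ≥ 0` under `μ(j↔b) ≤ μ(z↔b)`** (LEAD-GEN11 §3h claim (b), variant B), event form: for every weight vector `w` on
`Fin n` and every placement `v` of the terminals (`0=b,1=z,2=j,3=p,4=q`) with `μ({j↔b}) ≤ μ({z↔b})`,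
  `μ({j↔b}) + μ({z↔b} ∧ {p↮b} ∧ {q↮b} ∧ ({j↔p} ∨ {j↔q})) ≤ μ({z↔b}) + μ(({p↔b} ∨ {q↔b}) ∧ {z ↮ b,p,q,j})`.
[cite: VandenbergHaggstromKahn2005, Thm. 1.5 (p. 7), Thm. 2.1 (p. 9)] -/
theorem psiZeroB (w : Sym2 (Fin n) → unitInterval) (v : Fin 5 → Fin n)
    (hjz : (prodBernoulli w).real (fJB.set v) ≤ (prodBernoulli w).real (fZB.set v)) :
    (prodBernoulli w).real (fJB.set v) + (prodBernoulli w).real (fLAST.set v) ≤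
      (prodBernoulli w).real (fZB.set v) + (prodBernoulli w).real (fABEZ.set v) := by
  set x : ℕ → ℝ := fun m => (prodBernoulli w).real (Cell v m) with hxdef
  have hx : ∀ i, 0 ≤ x i := fun i => measureReal_nonneg
  have h1 := twoSetRow_holds w v [2] [1] [[(0, 1, false)]] [[]] fE2 [[]] (by decide) (by decide) (by decide) (by decide) [] 1
  have h2 := twoSetRow_holds w v [1] [2] [[(0, 2, false)]] fE2 [[]] [[]] (by decide) (by decide) (by decide) (by decide) [] 1
  have hhyp : linEval x (cellsOf fJB) ≤ linEval x (cellsOf fZB) := by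
    rw [← measureReal_set_eq_linEval, ← measureReal_set_eq_linEval]; exact hjz
  have key := psiVal_nonneg x hx h1 h2 hhyp
  simp only [psiVal, x, ← measureReal_set_eq_linEval] at key
  linarith

/-- The hypothesis event is `{j ↔ b}`. [folklore] -/
theorem set_fJB (v : Fin 5 → Fin n) : fJB.set v = (openConn (v 2) (v 0) : Set (BondConfig (Fin n))) := by
  ext ω
  simp only [fJB, mem_set_cons, not_mem_set_nil, List.forall_mem_cons, forall_mem_nil_iff, holds_true, and_true, or_false]

/-- The event `{z ↔ b}`. [folklore] -/
theorem set_fZB (v : Fin 5 → Fin n) : fZB.set v = (openConn (v 1) (v 0) : Set (BondConfig (Fin n))) := by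
  ext ω
  simp only [fZB, mem_set_cons, not_mem_set_nil, List.forall_mem_cons, forall_mem_nil_iff, holds_true, and_true, or_false]

/-- **`Ψ(0) ≥ 0` under `μ(j↔b) ≤ μ(z↔b)`**, with the hypothesis in `openConn` form. [this file] -/
theorem psiZeroB' (w : Sym2 (Fin n) → unitInterval) (v : Fin 5 → Fin n)
    (hjz : (prodBernoulli w).real (openConn (v 2) (v 0)) ≤ (prodBernoulli w).real (openConn (v 1) (v 0))) :
    (prodBernoulli w).real (openConn (v 2) (v 0)) + (prodBernoulli w).real (fLAST.set v) ≤
      (prodBernoulli w).real (openConn (v 1) (v 0)) + (prodBernoulli w).real (fABEZ.set v) := by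
  have := psiZeroB w v (by rw [set_fJB, set_fZB]; exact hjz)
  rwa [set_fJB, set_fZB] at this

end PsiZeroB

end Summit.CriticalPhenomena.PercolationContinuityZ3.Theorems

end
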